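import Summits.CriticalPhenomena.CardyFormulaZ2.Theorems.CardyComplexConeParafermionToSLESixFamiliesDiamondTurnCountSafe
import Literature.Probability.LatticeModels.MedialCornerWalkRuns
import HarnessLib

/-!
# The escape staircase of a touch site: the common prefix and its splicing with a route
# (line `potential-darboux-picard-diamond`, S1t `stub_freeSideTurnCount`, part 6)

Crux `ParafermionToSLESixFamilies` (stmt-CriticalPhenomena-11389), line `potential-darboux-picard-diamond`, stub
`stub_freeSideTurnCount` (S1t). In the frame of the side with outward direction `k` (coordinates `xiC k`, `upC k` of
`…DiamondTurnCountFrame.lean`; `E = u_k`, `N = u_{k+1}`, `W = u_{k+2}`, `S = u_{k+3}`) the escape path of the touch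
site `u` is `prefixPath k u K ++ Q` (definitions in `…DiamondTurnCountFrame.lean`), where the PREFIX

  `prefixPath k u K = [S, E, E] ++ E^{K - xiC u - 2} ++ S^{upC u - 1 + K}`

steps onto the `B`-site `u + S`, twice out, straight out along the row `upC = upC u - 1` to the column `xiC = K`, then
down that column to the FAR CORNER `v⋆ = (K, -K)` — the unique maximum of `xiC - upC`, i.e. the extreme corner of the side
functional — and the ROUTE `Q = W :: …` leads from `v⋆`, outside the diamond, back to the start vertex and does not
depend on `u`.

* Prefix bookkeeping: `head?_prefixPath`, `xiC_pathEnd_prefixPath`, `upC_pathEnd_prefixPath`, `walkTurns_prefixPath`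
  (signed turning `-1`), `mem_pathVerts_prefixPath`, `nodup_pathVerts_prefixPath`, `prefixPath_eq_append`.
* `splice_escapeData` (registered) — for a route whose vertices are `SafeVertex` for `u` (`…DiamondTurnCountSafe.lean`;
  the outside of the diamond enters only through an abstract indicator `ι : Site 2 → ℤ`): the spliced path starts with
  `S`, ends where `Q` ends, has the last direction of `Q`, no repeated vertex (end vertex included), every vertex after
  `u` is the `B`-site `u + S`, the site `u + S + E`, an outside site, or a route vertex; its corner walk contains the
  corner `(v⋆, k + 1)`, at which the side functional `sideVal (k + 2)` equals `2K - 1 + cK k` and which dominates every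
  corner of the walk; and its signed turning is `-1 + walkTurns (k + 1) Q` — INDEPENDENT of `u`.
-/

noncomputable section

namespace Summit.CriticalPhenomena.CardyFormulaZ2.Cruxes.ParafermionToSLESixFamilies.PotentialDarbouxPicardDiamond

open Literature.Probability Literature.Probability.LatticeModels

/-! ## The prefix -/

variable (k : Fin 4) (u : Site 2) (K : ℤ)

/-- The prefix starts by stepping onto the `B`-neighbour `u + u_{k+3}`. -/
theorem head?_prefixPath : (prefixPath k u K).head? = some (k + 3) := rfl

/-- The prefix as a cons-list. -/
theorem prefixPath_eq_cons : prefixPath k u K =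
    (k + 3) :: k :: k :: (List.replicate (K - xiC k u - 2).toNat k ++ List.replicate (upC k u - 1 + K).toNat (k + 3)) := rfl

/-- **Splitting off the last step**: `prefixPath = prefixInit ++ [S]` as soon as the descent is nonempty. -/
theorem prefixPath_eq_append (hK : 1 ≤ upC k u - 1 + K) : prefixPath k u K = prefixInit k u K ++ [k + 3] := by
  have hM : (upC k u - 1 + K).toNat = ((upC k u - 1 + K).toNat - 1) + 1 := by omega
  simp only [prefixPath, prefixInit, List.append_assoc]
  congr 2
  conv_lhs => rw [hM, List.replicate_succ']

/-- The prefix has at least three steps. -/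
theorem three_le_length_prefixPath : 3 ≤ (prefixPath k u K).length := by
  simp [prefixPath]

/-- **The end vertex of the prefix is the far corner**: `xiC = K`. -/
theorem xiC_pathEnd_prefixPath (hK1 : xiC k u + 2 ≤ K) :
    xiC k (pathEnd u (prefixPath k u K)) = K := by
  rw [prefixPath_eq_cons, pathEnd_cons, pathEnd_cons, pathEnd_cons, pathEnd_replicate_append, pathEnd_replicate]
  simp only [xiC_add_smul3, xiC_add_smul0, xiC_add_unit0, xiC_add_unit3]
  rw [Int.toNat_of_nonneg (by omega)]
  ring

/-- **The end vertex of the prefix is the far corner**: `upC = -K`. -/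
theorem upC_pathEnd_prefixPath (hK2 : 0 ≤ upC k u - 1 + K) :
    upC k (pathEnd u (prefixPath k u K)) = -K := by
  rw [prefixPath_eq_cons, pathEnd_cons, pathEnd_cons, pathEnd_cons, pathEnd_replicate_append, pathEnd_replicate]
  simp only [upC_add_smul3, upC_add_smul0, upC_add_unit0, upC_add_unit3]
  rw [Int.toNat_of_nonneg hK2]
  ring

/-- **The signed turning of the prefix is `-1`** (right at `u`, left at the `B`-site, straight, …, right at the
entry of the far column, straight down). -/
theorem walkTurns_prefixPath (hK2 : 1 ≤ upC k u - 1 + K) : walkTurns (k + 2) (prefixPath k u K) = -1 := by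
  have hM : (upC k u - 1 + K).toNat = ((upC k u - 1 + K).toNat - 1) + 1 := by omega
  rw [prefixPath_eq_cons, walkTurns, walkTurns, walkTurns]
  have c1 : ∀ k : Fin 4, ((k + 3 + 3 - (k + 2)).val : ℕ) = 0 := by decide
  have c2 : ∀ k : Fin 4, ((k + 3 - (k + 3 + 2)).val : ℕ) = 2 := by decide
  have c3 : ∀ k : Fin 4, ((k + 3 - (k + 2)).val : ℕ) = 1 := by decide
  have e1 : ∀ k : Fin 4, k + 3 + 2 = k + 1 := by decide
  rw [c1, c2, c3, walkTurns_replicate_append, hM, List.replicate_succ, walkTurns, c1, walkTurns_replicate]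
  norm_num

/-- **The vertices of the prefix**: `u`, the `B`-site `u + S`, the site `u + S + E`, the outward spur
(`upC = upC u - 1`, `xiC u + 2 ≤ xiC ≤ K - 1`) and the far column (`xiC = K`, `-K + 1 ≤ upC ≤ upC u - 1`). -/
theorem mem_pathVerts_prefixPath (hK1 : xiC k u + 2 ≤ K) {v : Site 2} (hv : v ∈ pathVerts u (prefixPath k u K)) :
    v = u ∨ v = u + cornerUnit (k + 3) ∨ v = u + cornerUnit (k + 3) + cornerUnit k ∨
      (upC k v = upC k u - 1 ∧ xiC k u + 2 ≤ xiC k v ∧ xiC k v ≤ K - 1) ∨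
      (xiC k v = K ∧ -K + 1 ≤ upC k v ∧ upC k v ≤ upC k u - 1) := by
  rw [prefixPath_eq_cons, pathVerts_cons, pathVerts_cons, pathVerts_cons, List.mem_cons, List.mem_cons, List.mem_cons,
    mem_pathVerts_replicate_append, mem_pathVerts_replicate] at hv
  rcases hv with h | h | h | ⟨i, hi, h⟩ | ⟨i, hi, h⟩
  · exact Or.inl h
  · exact Or.inr (Or.inl h)
  · exact Or.inr (Or.inr (Or.inl h))
  · refine Or.inr (Or.inr (Or.inr (Or.inl ?_)))
    have hx := congrArg (xiC k) h
    have hy := congrArg (upC k) h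
    simp only [xiC_add_smul0, xiC_add_unit0, xiC_add_unit3, upC_add_smul0, upC_add_unit0, upC_add_unit3] at hx hy
    omega
  · refine Or.inr (Or.inr (Or.inr (Or.inr ?_)))
    have hx := congrArg (xiC k) h
    have hy := congrArg (upC k) h
    simp only [xiC_add_smul3, xiC_add_smul0, xiC_add_unit0, xiC_add_unit3, upC_add_smul3, upC_add_smul0, upC_add_unit0,
      upC_add_unit3] at hx hy
    omega

/-- **The prefix has no repeated vertex.** -/
theorem nodup_pathVerts_prefixPath : ∀ (k : Fin 4) (u : Site 2) (K : ℤ), xiC k u + 2 ≤ K → (pathVerts u (prefixPath k u K)).Nodup := by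
  intro k u K hK1
  -- coordinates of the vertices after the first three
  have hrest : ∀ v ∈ pathVerts (u + cornerUnit (k + 3) + cornerUnit k + cornerUnit k)
      (List.replicate (K - xiC k u - 2).toNat k ++ List.replicate (upC k u - 1 + K).toNat (k + 3)),
      (upC k v = upC k u - 1 ∧ xiC k u + 2 ≤ xiC k v ∧ xiC k v ≤ K - 1) ∨
        (xiC k v = K ∧ -K + 1 ≤ upC k v ∧ upC k v ≤ upC k u - 1) := by
    intro v hv
    rw [mem_pathVerts_replicate_append, mem_pathVerts_replicate] at hv
    rcases hv with ⟨i, hi, h⟩ | ⟨i, hi, h⟩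
    · left
      have hx := congrArg (xiC k) h
      have hy := congrArg (upC k) h
      simp only [xiC_add_smul0, xiC_add_unit0, xiC_add_unit3, upC_add_smul0, upC_add_unit0, upC_add_unit3] at hx hy
      omega
    · right
      have hx := congrArg (xiC k) h
      have hy := congrArg (upC k) h
      simp only [xiC_add_smul3, xiC_add_smul0, xiC_add_unit0, xiC_add_unit3, upC_add_smul3, upC_add_smul0,
        upC_add_unit0, upC_add_unit3] at hx hy
      omega
  rw [prefixPath_eq_cons, pathVerts_cons, pathVerts_cons, pathVerts_cons, List.nodup_cons, List.nodup_cons,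
    List.nodup_cons]
  refine ⟨fun h => ?_, fun h => ?_, fun h => ?_, ?_⟩
  · rw [List.mem_cons, List.mem_cons] at h
    rcases h with h | h | h
    · have := congrArg (upC k) h; simp at this; omega
    · have := congrArg (upC k) h; simp at this; omega
    · rcases hrest _ h with h | h <;> omega
  · rw [List.mem_cons] at h
    rcases h with h | h
    · have := congrArg (xiC k) h; simp at this
    · rcases hrest _ h with h | h <;> simp only [xiC_add_unit3, upC_add_unit3] at h <;> omega
  · rcases hrest _ h with h | h <;> simp only [xiC_add_unit0, upC_add_unit0, xiC_add_unit3, upC_add_unit3] at h <;> omega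
  · rw [nodup_pathVerts_replicate_append]
    refine ⟨nodup_pathVerts_replicate _ _ _, fun v hv ⟨i, hi, h⟩ => ?_⟩
    obtain ⟨i', -, h'⟩ := mem_pathVerts_replicate.1 hv
    have hx := congrArg (xiC k) h
    have hx' := congrArg (xiC k) h'
    simp only [xiC_add_smul3, xiC_add_smul0, xiC_add_unit0, xiC_add_unit3] at hx hx'
    omega

/-! ## Splicing the prefix with a route -/

/-- **Splicing the prefix with a route** (registered helper of `stub_freeSideTurnCount`). See the module docstring. -/
theorem splice_escapeData : ∀ (k : Fin 4) (u : Site 2) (K : ℤ) (ι : Site 2 → ℤ) (Qt : List (Fin 4)), xiC k u + 2 ≤ K → 1 ≤ upC k u - 1 + K → ι u = 1 → ι (u + cornerUnit (k + 3)) = 1 → (∀ v : Site 2, upC k v = upC k u - 1 → xiC k u + 2 ≤ xiC k v → ι v = 0) → (∀ v : Site 2, xiC k v = K → ι v = 0) → (∀ b ∈ pathVerts (pathEnd u (prefixPath k u K)) ((k + 2) :: Qt), SafeVertex k u K ι b) → (pathVerts (pathEnd u (prefixPath k u K)) ((k + 2) :: Qt)).Nodup → pathEnd (pathEnd u (prefixPath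 k u K)) ((k + 2) :: Qt) ∉ pathVerts (pathEnd u (prefixPath k u K)) ((k + 2) :: Qt) → ι (pathEnd (pathEnd u (prefixPath k u K)) ((k + 2) :: Qt)) = 1 → ¬ (xiC k u ≤ xiC k (pathEnd (pathEnd u (prefixPath k u K)) ((k + 2) :: Qt)) ∧ xiC k (pathEnd (pathEnd u (prefixPath k u K)) ((k + 2) :: Qt)) ≤ xiC k u + 1 ∧ upC k u - 1 ≤ upC k (pathEnd (pathEnd u (prefixPath k u K)) ((k + 2) :: Qt)) ∧ upC k (pathEnd (pathEnd u (prefixPath k u K)) ((k + 2) :: Qt)) ≤ upC k u) → (∀ b ∈ pathVerts (pathEnd u (prefixPath k u K)) ((k + 2) :: Qt), b = pathEnd u (prefixPath k u K) ∨ xiC k b - upC k b ≤ 2 * K - 1) → (prefixPath k u K ++ (k + 2) :: Qt).head? = some (k + 2 + 1) ∧ 2 ≤ (prefixPath k u K ++ (k + 2) :: Qt).length ∧ pathEnd u (prefixPath k u K ++ (k + 2) :: Qt) = pathEnd (pathEnd u (prefixPath k u K)) ((k + 2) :: Qt) ∧ lastDir (prefixPath k u K ++ (k + 2) :: Qt)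 = lastDir ((k + 2) :: Qt) ∧ (pathVerts u (prefixPath k u K ++ (k + 2) :: Qt) ++ [pathEnd (pathEnd u (prefixPath k u K)) ((k + 2) :: Qt)]).Nodup ∧ (∀ v ∈ (pathVerts u (prefixPath k u K ++ (k + 2) :: Qt)).tail, v = u + cornerUnit (k + 3) ∨ v = u + cornerUnit (k + 3) + cornerUnit k ∨ ι v = 0 ∨ v ∈ pathVerts (pathEnd u (prefixPath k u K)) ((k + 2) :: Qt)) ∧ (pathEnd u (prefixPath k u K), k + 1) ∈ cornerWalk u (k + 2) (prefixPath k u K ++ (k + 2) :: Qt) ∧ sideVal (k + 2) (cpos (pathEnd u (prefixPath k u K), k + 1)) = 2 * K - 1 + cK k ∧ (∀ d ∈ cornerWalk u (k + 2) (prefixPath k u K ++ (k + 2) :: Qt), sideVal (k + 2) (cpos d) ≤ 2 * K - 1 + cK k) ∧ walkTurns (k + 2) (prefixPath k u K ++ (k + 2) :: Qt) = -1 + walkTurns (k + 1) ((k + 2) :: Qt) := by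
  intro k u K ι Qt hK1 hK2 hιu hιb hιE hιS hsafe hQnd hx hιx hxbox hreg
  have fin4_add_three_add_two : ∀ k : Fin 4, k + 3 + 2 = k + 1 := by decide
  have fan_val_eq_zero : ∀ k : Fin 4, ((k + 2 + 3 - (k + 1)).val : ℕ) = 0 := by decide
  set P := prefixPath k u K with hP
  set vs := pathEnd u P with hvs
  set Q : List (Fin 4) := (k + 2) :: Qt with hQ
  set x₀ := pathEnd vs Q with hx₀
  have hvs1 : xiC k vs = K := xiC_pathEnd_prefixPath k u K hK1
  have hvs2 : upC k vs = -K := upC_pathEnd_prefixPath k u K (by omega)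
  have hPverts := fun v (hv : v ∈ pathVerts u P) => mem_pathVerts_prefixPath k u K hK1 hv
  have hPnd : (pathVerts u P).Nodup := nodup_pathVerts_prefixPath k u K hK1
  have hsplit : P = prefixInit k u K ++ [k + 3] := prefixPath_eq_append k u K hK2
  -- no vertex of the prefix is a safe vertex, nor the end vertex
  have hPsafe : ∀ a ∈ pathVerts u P, ¬ SafeVertex k u K ι a := by
    intro a ha hs
    rcases hPverts a ha with rfl | rfl | rfl | ⟨h1, h2, h3⟩ | ⟨h1, h2, h3⟩
    · rcases hs with ⟨h, -, -⟩ | ⟨-, h⟩ <;> omega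
    · rcases hs with ⟨h, -, -⟩ | ⟨-, h⟩
      · omega
      · simp only [xiC_add_unit3, upC_add_unit3] at h; omega
    · rcases hs with ⟨-, h, -⟩ | ⟨-, h⟩ <;>
        simp only [xiC_add_unit0, upC_add_unit0, xiC_add_unit3, upC_add_unit3, true_and] at h <;> omega
    · have := hιE a h1 h2
      rcases hs with ⟨-, h, -⟩ | ⟨h, -⟩ <;> omega
    · have := hιS a h1
      rcases hs with ⟨-, -, h⟩ | ⟨h, -⟩ <;> omega
  have hPx : x₀ ∉ pathVerts u P := by
    intro ha
    rcases hPverts x₀ ha with h | h | h | ⟨h1, h2, -⟩ | ⟨h1, -, -⟩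
    · rw [h] at hxbox; omega
    · rw [h] at hxbox; simp only [xiC_add_unit3, upC_add_unit3] at hxbox; omega
    · rw [h] at hxbox; simp only [xiC_add_unit0, upC_add_unit0, xiC_add_unit3, upC_add_unit3] at hxbox; omega
    · have := hιE x₀ h1 h2; omega
    · have := hιS x₀ h1; omega
  have hverts : pathVerts u (P ++ Q) = pathVerts u P ++ pathVerts vs Q := pathVerts_append u P Q
  refine ⟨?_, ?_, ?_, ?_, ?_, ?_, ?_, ?_, ?_, ?_⟩
  · -- first step
    rw [List.head?_append, head?_prefixPath, fin4_add_two_add_one]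
    rfl
  · -- length
    have h3 : 3 ≤ P.length := three_le_length_prefixPath k u K
    rw [List.length_append]; omega
  · -- end vertex
    exact pathEnd_append u P Q
  · -- last direction
    exact lastDir_append_of_ne_nil P (List.cons_ne_nil _ _)
  · -- no repeated vertex, end vertex included
    rw [hverts, List.append_assoc, List.nodup_append]
    refine ⟨hPnd, ?_, fun a ha b hb hab => ?_⟩
    · rw [List.nodup_append]
      refine ⟨hQnd, List.nodup_singleton _, fun a ha b hb hab => ?_⟩
      rw [List.mem_singleton] at hb
      rw [hab, hb] at ha
      exact hx ha
    · rw [List.mem_append, List.mem_singleton] at hb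
      subst hab
      rcases hb with hb | rfl
      · exact hPsafe a ha (hsafe a hb)
      · exact hPx ha
  · -- the vertices after `u`
    intro v hv
    have hv' : v ∈ pathVerts u (P ++ Q) := List.mem_of_mem_tail hv
    rw [hverts, List.mem_append] at hv'
    rcases hv' with hv' | hv'
    · rcases hPverts v hv' with rfl | h | h | ⟨h1, h2, -⟩ | ⟨h1, -, -⟩
      · -- `u` itself is not in the tail
        exfalso
        rw [hverts, hP, prefixPath_eq_cons, pathVerts_cons, List.cons_append, List.tail_cons, List.mem_append] at hv
        have hnd := hPnd
        rw [hP, prefixPath_eq_cons, pathVerts_cons, List.nodup_cons] at hnd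
        rcases hv with hv | hv
        · exact hnd.1 hv
        · exact hPsafe v (by rw [hP, prefixPath_eq_cons, pathVerts_cons]; exact List.mem_cons_self) (hsafe v hv)
      · exact Or.inl h
      · exact Or.inr (Or.inl h)
      · exact Or.inr (Or.inr (Or.inl (hιE v h1 h2)))
      · exact Or.inr (Or.inr (Or.inl (hιS v h1)))
    · exact Or.inr (Or.inr (Or.inr hv'))
  · -- the far corner is a corner of the walk
    rw [hsplit, cornerWalk_append, ← hsplit, hQ, cornerWalk_cons, fin4_add_three_add_two, fan_val_eq_zero]
    exact List.mem_append_right _ (List.mem_append_left _ (by rw [hvs]; simp [fanL]))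
  · -- its side functional
    rw [sideVal_cpos_extreme, hvs1, hvs2]; ring
  · -- it dominates every corner of the walk
    intro d hd
    rw [hsplit, cornerWalk_append, ← hsplit, cornerWalk_cons, fin4_add_three_add_two, fan_val_eq_zero, List.mem_append,
      List.mem_append] at hd
    have hreg' : ∀ b ∈ pathVerts vs Q, b ≠ vs → xiC k b - upC k b ≤ 2 * K - 1 := fun b hb hne =>
      (hreg b hb).resolve_left hne
    rcases hd with hd | hd | hd
    · -- corners of the prefix walk sit at prefix vertices
      have hv := fst_mem_pathVerts hd
      refine (sideVal_cpos_le k d.1 d.2).trans ?_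
      rcases hPverts d.1 hv with h | h | h | ⟨h1, h2, h3⟩ | ⟨h1, h2, h3⟩
      · rw [h]; omega
      · rw [h]; simp only [xiC_add_unit3, upC_add_unit3]; omega
      · rw [h]; simp only [xiC_add_unit0, upC_add_unit0, xiC_add_unit3, upC_add_unit3]; omega
      · omega
      · omega
    · -- the far corner itself
      simp only [fanL, List.mem_singleton] at hd
      rw [hd, sideVal_cpos_extreme, hvs1, hvs2]; omega
    · -- corners of the route walk sit at route vertices other than the far corner
      have hv := fst_mem_pathVerts hd
      refine (sideVal_cpos_le k d.1 d.2).trans ?_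
      have hmem : d.1 ∈ pathVerts vs Q := by
        rw [hQ, pathVerts_cons]; exact List.mem_cons_of_mem _ hv
      have hne : d.1 ≠ vs := by
        intro heq
        rw [hQ, pathVerts_cons, List.nodup_cons] at hQnd
        rw [heq] at hv
        exact hQnd.1 hv
      have := hreg' d.1 hmem hne
      omega
  · -- the signed turning
    rw [hsplit, walkTurns_append, ← hsplit, walkTurns_prefixPath k u K hK2, fin4_add_three_add_two]

end Summit.CriticalPhenomena.CardyFormulaZ2.Cruxes.ParafermionToSLESixFamilies.PotentialDarbouxPicardDiamond

end
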